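import Mathlib
import Summits.NavierStokesRegularity.NavierStokesRegularity.Theorems.TaoLadderRungTwoBreakBlowupRigidityOneViscousLawClosure
import Summits.NavierStokesRegularity.NavierStokesRegularity.Theorems.TaoLadderRungTwoBreakBlowupRigidityOneRenormalisedViscousFlow
import HarnessLib

/-!
# The extraction from a VISCOUS clocked front at ratio `Λν_r ≥ (1+ε₀)²` (critical OR strict): the ω-limit is an admissible
  VISCOUS eternal solution `IsEternalVisc ε₀ ν̂ α W` with `0 ≤ ν̂ ≤ ν√κ₂`, surviving forward — the K2(1)/K2ᵛ boundary for
  `TaoLadderRungTwoBreak.BlowupRigidityOne` (stmt-NavierStokesRegularity-20206) versus `EternalRigidityViscBddOne` ⟨20420⟩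

MODEL lattice ODEs only (Tao 2016 §4 (4.8), the viscous equation before Thm. 4.2, §6.4); nothing here is a statement about
the Navier–Stokes equations; NO item is closed (`--supports stmt-NavierStokesRegularity-20206`). Route-independent (general `m`).

Along a `ν`-viscous flow the `j`-th firing-centred translate obeys the eternal law with damping `ν θ_j (1+ε₀)^{2n}e^{-u}`,
`θ_j = (1+ε₀)^{2j}(T-τ_j)`. If the front ratio satisfies `Λν_r ≥ (1+ε₀)²` (for `a = 1`: `ν_r² ≥ (1+ε₀)^{-1}`, the (S₁)
clause itself), the upper clock gives `θ_j ≤ √κ₂`; Bolzano–Weierstrass along the Arzelà–Ascoli subsequence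
(`exists_subseq_continuousLimit_param`) gives `θ_j → θ_∞ ∈ [0, √κ₂]`, the law is the `IsEternalVisc ε₀ (νθ_∞) α` law up to the
perturbation `ν(θ_∞ - θ_j)(1+ε₀)^{2n}e^{-u}V_j → 0` (`viscousLaw_of_perturbedLimit_local`), and action / envelope / survival
pass to the limit kinematically. STRICT ratio forces `θ_∞ = 0` (`eternal_surviving_of_viscousClockedFront`: the object of
K2(1)'s `stub_eternalFromBlowup`); at the CRITICAL ratio `ν̂ = νθ_∞` may be positive — the object of K2ᵛ ⟨20420⟩ (which in
addition asks `UniformBound`, a type-I input not available from the front data alone).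

* `eternalVisc_surviving_of_viscousClockedFront` — `ν`-viscous flow on `[0,T)` (`ν ≥ 0`) + action ceiling + amplitude ceiling
  `B ν_r^j` + clocked firing floor + `Λ²ν_r² > 1`, `1 ≤ physWeight a ε₀·Λ²ν_r²` + `(1+ε₀)² ≤ Λν_r`
  ⇒ `∃ ν̂ ∈ [0, ν√κ₂], ∃ W, IsEternalVisc ε₀ ν̂ α W ∧ EternalSurvivingFwd a ε₀ W`.

HONEST LABEL: a conditional reduction; the viscous front bundle is OPEN; `UniformBound` is not produced; no stub, crux or
summit is proved here.
-/

noncomputable section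

-- the summit and its single sub-problem share the name (CONVENTIONS §1)
set_option linter.dupNamespace false

open Set Filter Topology MeasureTheory

namespace Summit.NavierStokesRegularity.NavierStokesRegularity.Theorems

namespace BlowupRigidityOne

open Literature.Analysis.FluidPDE Literature.Analysis.FluidPDE.TaoCascade
open Summit.NavierStokesRegularity.NavierStokesRegularity.Cruxes.MinimalBlowupExtraction.Extraction
  (exists_subseq_continuousLimit_param)

variable {m : ℕ}

/-- **THE EXTRACTION FROM A VISCOUS CLOCKED FRONT AT RATIO `Λν_r ≥ (1+ε₀)²` (critical or strict; general exponent
`a`).** Let `X` be a `ν`-VISCOUS flow of `α` on `[0,T)` (`T > 0`, `ν ≥ 0`; one-sided law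
`∂ₜX_{i,n} = quadTerm_{i,n}(X) - ν(1+ε₀)^{2n}X_{i,n}`) with renormalisation `W̃`; assume the per-shell ACTION CEILING
`Λ^k ∫_{[0,T)}‖x_k‖ ≤ A`, the AMPLITUDE CEILING `‖x_j(t)‖ ≤ B ν_r^j` (`ν_r > 0`), firing times `τ_k ∈ [0,T)` with FLOOR
`c_f (ν_r²)^k ≤ ‖x_k(τ_k)‖²` and two-sided CLOCK `κ₁ ≤ (Λ²ν_r²)^k (T-τ_k)² ≤ κ₂`, `Λ²ν_r² > 1`,
`1 ≤ physWeight a ε₀ · Λ²ν_r²`, and `(1+ε₀)² ≤ Λν_r`. Then for some `ν̂ ∈ [0, ν√κ₂]` a continuous limit `W` of the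
firing-centred translates is an admissible VISCOUS eternal solution `IsEternalVisc ε₀ ν̂ α W` (covariant viscosity
`ν̂ = ν·lim_j (1+ε₀)^{2φ_j}(T-τ_{φ_j})` along the extracted subsequence) that is forward (S_a)-surviving.
[cite: Tao2016AveragedNS, §4 (4.8) and the viscous equation before Thm. 4.2, §6.4; KochNadirashviliSereginSverak2009, Thm 1.1 ff. (rescaling-compactness); cell vocabulary (`IsEternalVisc`, `EternalSurvivingFwd`)] -/
theorem eternalVisc_surviving_of_viscousClockedFront {ε₀ ν T A B νr cf κ₁ κ₂ a : ℝ} (hε : 0 < ε₀) (hT : 0 < T)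
    (hνv : 0 ≤ ν)
    {α : Fin m → Fin m → Fin m → ℤ × ℤ × ℤ → ℝ}
    {X : Fin m → ℤ → ℝ → ℝ} (hC1 : ∀ i n, ContDiffOn ℝ 1 (X i n) (Set.Ico 0 T))
    (hmot : ∀ i n t, 0 ≤ t → t < T → derivWithin (X i n) (Set.Ici 0) t =
      quadTerm ε₀ α X i n t - ν * (1 + ε₀) ^ ((2 : ℝ) * n) * X i n t)
    {W : ℤ → ℝ → Em m}
    (hW : ∀ n σ, W n σ = (bigLam ε₀ ^ n * Real.exp (-σ)) • shellVec X n (T - Real.exp (-σ)))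
    (hact : ∀ k : ℤ, IntegrableOn (fun t => ‖shellVec X k t‖) (Ico 0 T) ∧
      bigLam ε₀ ^ k * (∫ t in Ico 0 T, ‖shellVec X k t‖) ≤ A)
    (hν : 0 < νr) (hamp : ∀ (j : ℤ) (t : ℝ), 0 ≤ t → t < T → ‖shellVec X j t‖ ≤ B * νr ^ j)
    {τ : ℕ → ℝ} (hτ : ∀ k : ℕ, 0 ≤ τ k ∧ τ k < T)
    (hfloor : ∀ k : ℕ, cf * (νr ^ 2) ^ k ≤ ‖shellVec X (k : ℤ) (τ k)‖ ^ 2)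
    (hclock₁ : ∀ k : ℕ, κ₁ ≤ (bigLam ε₀ ^ 2 * νr ^ 2) ^ k * (T - τ k) ^ 2)
    (hclock₂ : ∀ k : ℕ, (bigLam ε₀ ^ 2 * νr ^ 2) ^ k * (T - τ k) ^ 2 ≤ κ₂)
    (hcf : 0 < cf) (hκ₁ : 0 < κ₁) (hκ₂ : 0 < κ₂) (hq1 : 1 < bigLam ε₀ ^ 2 * νr ^ 2)
    (hpw : 1 ≤ physWeight a ε₀ * (bigLam ε₀ ^ 2 * νr ^ 2))
    (hcrit : (1 + ε₀) ^ 2 ≤ bigLam ε₀ * νr) :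
    ∃ νh : ℝ, 0 ≤ νh ∧ νh ≤ ν * Real.sqrt κ₂ ∧
      ∃ Wlim : ℤ → ℝ → Em m, IsEternalVisc ε₀ νh α Wlim ∧ EternalSurvivingFwd a ε₀ Wlim := by
  have hb : (0 : ℝ) < 1 + ε₀ := by linarith
  have hΛ : 0 < bigLam ε₀ := bigLam_pos (by linarith)
  have hB : 0 ≤ B := by
    have h := hamp 0 0 le_rfl hT
    rw [zpow_zero, mul_one] at h
    exact (norm_nonneg _).trans h
  set q : ℝ := bigLam ε₀ ^ 2 * νr ^ 2 with hq_def
  have hq : 0 < q := by positivity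
  set ρ : ℝ := bigLam ε₀ * νr with hρ_def
  have hρ : 0 < ρ := by positivity
  have hρq : ρ ^ 2 = q := by rw [hρ_def, hq_def]; ring
  have hρ1 : 1 ≤ ρ := by
    by_contra h
    push Not at h
    have : ρ ^ 2 < 1 := pow_lt_one₀ hρ.le h two_ne_zero
    linarith
  set L2 : ℝ := (1 + ε₀) ^ 2 with hL2_def
  have hL2 : 0 < L2 := by positivity
  have hP2 : ∀ k : ℤ, (1 + ε₀) ^ ((2 : ℝ) * (k : ℝ)) = L2 ^ k := fun k => by
    rw [Real.rpow_mul hb.le, Real.rpow_two, ← Real.rpow_intCast]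
  have gap : ∀ j : ℕ, 0 < T - τ j := fun j => by linarith [(hτ j).2]
  have hup : ∀ j : ℕ, ρ ^ j * (T - τ j) ≤ Real.sqrt κ₂ := by
    intro j
    have h : (ρ ^ j * (T - τ j)) ^ 2 ≤ κ₂ := by
      rw [mul_pow, ← pow_mul, mul_comm j 2, pow_mul, hρq]; exact hclock₂ j
    exact (le_abs_self _).trans (Real.abs_le_sqrt h)
  set θ : ℕ → ℝ := fun j => L2 ^ j * (T - τ j) with hθ_def
  have hθ0 : ∀ j : ℕ, 0 ≤ θ j := fun j => mul_nonneg (pow_pos hL2 j).le (gap j).le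
  have hθle : ∀ j : ℕ, θ j ≤ Real.sqrt κ₂ := by
    intro j
    have h1 : L2 ^ j ≤ ρ ^ j := pow_le_pow_left₀ hL2.le hcrit j
    calc L2 ^ j * (T - τ j) ≤ ρ ^ j * (T - τ j) := mul_le_mul_of_nonneg_right h1 (gap j).le
      _ ≤ Real.sqrt κ₂ := hup j
  have hθmem : ∀ j : ℕ, θ j ∈ Icc (0 : ℝ) (Real.sqrt κ₂) := fun j => ⟨hθ0 j, hθle j⟩
  set s : ℕ → ℝ := fun j => -Real.log (T - τ j) with hs_def
  have hs : Tendsto s atTop atTop := by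
    have hlq : 0 < Real.log q := Real.log_pos hq1
    have hlow : ∀ j : ℕ, ((j : ℝ) * Real.log q + -Real.log κ₂) / 2 ≤ s j := by
      intro j
      have h1 : (T - τ j) ^ 2 ≤ κ₂ / q ^ j := by
        rw [le_div_iff₀ (pow_pos hq j), mul_comm]; exact hclock₂ j
      have h2 : Real.log ((T - τ j) ^ 2) ≤ Real.log (κ₂ / q ^ j) := Real.log_le_log (pow_pos (gap j) 2) h1
      rw [Real.log_pow, Real.log_div hκ₂.ne' (pow_pos hq j).ne', Real.log_pow] at h2
      push_cast at h2
      show ((j : ℝ) * Real.log q + -Real.log κ₂) / 2 ≤ -Real.log (T - τ j)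
      linarith
    exact tendsto_atTop_mono hlow ((tendsto_atTop_add_const_right _ _
      (tendsto_natCast_atTop_atTop.atTop_mul_const hlq)).atTop_div_const two_pos)
  have hexps : ∀ (j : ℕ) (u : ℝ), Real.exp (-(u + s j)) = Real.exp (-u) * (T - τ j) := by
    intro j u
    rw [neg_add, Real.exp_add, hs_def]
    simp only [neg_neg]
    rw [Real.exp_log (gap j)]
  set av : ℕ → ℝ := fun j => -Real.log T - s j with hav_def
  have hwin : ∀ (j : ℕ) (u : ℝ), av j < u → Real.exp (-(u + s j)) < T := by
    intro j u hu
    have hu' : -(u + s j) < Real.log T := by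
      have : -Real.log T - s j < u := hu
      linarith
    calc Real.exp (-(u + s j)) < Real.exp (Real.log T) := Real.exp_lt_exp.2 hu'
      _ = T := Real.exp_log hT
  have hav : Tendsto av atTop atBot := by
    refine tendsto_atBot.2 fun b => ?_
    exact (hs.eventually (eventually_ge_atTop (-Real.log T - b))).mono fun j hj => by
      show -Real.log T - s j ≤ b
      linarith
  set g : ℕ → ℤ → ℝ → Em m := fun j n u => W (n + (j : ℤ)) (u + s j) with hg_def
  set c : ℕ → ℤ → ℝ → ℝ := fun j n u => ν * ((1 + ε₀) ^ ((2 : ℝ) * ((n + (j : ℤ) : ℤ) : ℝ)) * Real.exp (-(u + s j)))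
    with hc_def
  have hlawg : ∀ (j : ℕ) (n : ℤ) (u : ℝ), av j < u → HasDerivAt (g j n)
      (-((1 : ℝ) • g j n u) + tableQ α (g j n u) + bigLam ε₀ • tableA α (g j (n - 1) u)
        + (bigLam ε₀)⁻¹ • tableB α (g j (n + 1) u) (g j n u) - c j n u • g j n u) u := by
    intro j n u hu
    have h := (renormalisedViscousFlow_law hε hC1 hmot hW (n + (j : ℤ)) (hwin j u hu)).comp_add_const u (s j)
    have e1 : n + (j : ℤ) - 1 = n - 1 + (j : ℤ) := by ring
    have e2 : n + (j : ℤ) + 1 = n + 1 + (j : ℤ) := by ring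
    rw [e1, e2] at h
    simpa only [hg_def, hc_def] using h
  have hc_eq : ∀ (j : ℕ) (n : ℤ) (u : ℝ), c j n u = ν * (L2 ^ n * Real.exp (-u)) * θ j := by
    intro j n u
    show ν * ((1 + ε₀) ^ ((2 : ℝ) * ((n + (j : ℤ) : ℤ) : ℝ)) * Real.exp (-(u + s j))) = ν * (L2 ^ n * Real.exp (-u)) * (L2 ^ j * (T - τ j))
    rw [hP2, hexps, zpow_add₀ hL2.ne', zpow_natCast]
    ring
  have hc_cont : ∀ (j : ℕ) (n : ℤ), Continuous (c j n) := by
    intro j n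
    show Continuous fun u => ν * ((1 + ε₀) ^ ((2 : ℝ) * ((n + (j : ℤ) : ℤ) : ℝ)) * Real.exp (-(u + s j)))
    fun_prop
  have hgb : ∀ (j : ℕ) (n : ℤ) (u : ℝ), av j < u → ‖g j n u‖ ≤ B * Real.sqrt κ₂ * Real.exp (-u) * ρ ^ n := by
    intro j n u hu
    have hwu := hwin j u hu
    have ht0 : 0 ≤ T - Real.exp (-(u + s j)) := by linarith
    have htT : T - Real.exp (-(u + s j)) < T := by linarith [Real.exp_pos (-(u + s j))]
    have hx := hamp (n + (j : ℤ)) _ ht0 htT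
    have hexp : Real.exp (-(u + s j)) = Real.exp (-u) * (T - τ j) := hexps j u
    have hnorm : ‖g j n u‖ = bigLam ε₀ ^ (n + (j : ℤ)) * Real.exp (-(u + s j)) *
        ‖shellVec X (n + (j : ℤ)) (T - Real.exp (-(u + s j)))‖ := renormalisedFlow_norm hε hW _ _
    rw [hnorm, hexp]
    have hΛk : 0 < bigLam ε₀ ^ (n + (j : ℤ)) := zpow_pos hΛ _
    have hsplit : bigLam ε₀ ^ (n + (j : ℤ)) * (B * νr ^ (n + (j : ℤ))) = B * ρ ^ n * ρ ^ j := by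
      rw [hρ_def, mul_zpow, ← zpow_natCast (bigLam ε₀ * νr) j, mul_zpow, zpow_add₀ hΛ.ne', zpow_add₀ hν.ne']
      ring
    calc bigLam ε₀ ^ (n + (j : ℤ)) * (Real.exp (-u) * (T - τ j)) *
          ‖shellVec X (n + (j : ℤ)) (T - Real.exp (-u) * (T - τ j))‖
        ≤ bigLam ε₀ ^ (n + (j : ℤ)) * (Real.exp (-u) * (T - τ j)) * (B * νr ^ (n + (j : ℤ))) := by
          refine mul_le_mul_of_nonneg_left ?_ (mul_nonneg hΛk.le (mul_nonneg (Real.exp_pos _).le (gap j).le))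
          rw [← hexp]; exact hx
      _ = B * Real.exp (-u) * ρ ^ n * (ρ ^ j * (T - τ j)) := by
          calc bigLam ε₀ ^ (n + (j : ℤ)) * (Real.exp (-u) * (T - τ j)) * (B * νr ^ (n + (j : ℤ)))
              = Real.exp (-u) * (T - τ j) * (bigLam ε₀ ^ (n + (j : ℤ)) * (B * νr ^ (n + (j : ℤ)))) := by ring
            _ = Real.exp (-u) * (T - τ j) * (B * ρ ^ n * ρ ^ j) := by rw [hsplit]
            _ = B * Real.exp (-u) * ρ ^ n * (ρ ^ j * (T - τ j)) := by ring
      _ ≤ B * Real.exp (-u) * ρ ^ n * Real.sqrt κ₂ :=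
          mul_le_mul_of_nonneg_left (hup j) (by positivity)
      _ = B * Real.sqrt κ₂ * Real.exp (-u) * ρ ^ n := by ring
  have hJ : ∀ a' : ℝ, ∃ J : ℕ, ∀ j, J ≤ j → av j < a' := fun a' =>
    eventually_atTop.1 (hav.eventually (eventually_lt_atBot a'))
  have hhalf : ∀ (n k : ℤ) (a' : ℝ), k ≤ n + 1 → ∀ (j : ℕ) (u : ℝ), av j < a' → a' ≤ u →
      ‖g j k u‖ ≤ B * Real.sqrt κ₂ * Real.exp (-a') * ρ ^ (n + 1) := by
    intro n k a' hk j u hja hu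
    have h := hgb j k u (lt_of_lt_of_le hja hu)
    have h1 : Real.exp (-u) ≤ Real.exp (-a') := Real.exp_le_exp.2 (by linarith)
    have h2 : ρ ^ k ≤ ρ ^ (n + 1) := zpow_le_zpow_right₀ hρ1 hk
    calc ‖g j k u‖ ≤ B * Real.sqrt κ₂ * Real.exp (-u) * ρ ^ k := h
      _ ≤ B * Real.sqrt κ₂ * Real.exp (-a') * ρ ^ (n + 1) :=
          mul_le_mul (mul_le_mul_of_nonneg_left h1 (by positivity)) h2 (zpow_pos hρ _).le (by positivity)
  have hcb : ∀ (n : ℤ) (a' : ℝ) (j : ℕ) (u : ℝ), av j < a' → a' ≤ u →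
      ‖c j n u • g j n u‖ ≤ ν * (L2 ^ n * Real.exp (-a')) * Real.sqrt κ₂
        * (B * Real.sqrt κ₂ * Real.exp (-a') * ρ ^ (n + 1)) := by
    intro n a' j u hja hu
    have hcn : 0 ≤ c j n u := by
      rw [hc_eq]; exact mul_nonneg (mul_nonneg hνv (mul_nonneg (zpow_pos hL2 _).le (Real.exp_pos _).le)) (hθ0 j)
    have hcle : c j n u ≤ ν * (L2 ^ n * Real.exp (-a')) * Real.sqrt κ₂ := by
      rw [hc_eq]
      have h1 : Real.exp (-u) ≤ Real.exp (-a') := Real.exp_le_exp.2 (by linarith)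
      exact mul_le_mul (mul_le_mul_of_nonneg_left (mul_le_mul_of_nonneg_left h1 (zpow_pos hL2 _).le) hνv)
        (hθle j) (hθ0 j) (by positivity)
    rw [norm_smul, Real.norm_eq_abs, abs_of_nonneg hcn]
    exact mul_le_mul hcle (hhalf n n a' (by linarith) j u hja hu) (norm_nonneg _) (by positivity)
  have hAB : ∀ (n : ℤ) (a' : ℝ), ∃ C' : ℝ, ∃ J : ℕ, ∀ j, J ≤ j → ∀ u : ℝ, a' ≤ u → ‖g j n u‖ ≤ C' := by
    intro n a'
    obtain ⟨J, hJ'⟩ := hJ a'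
    exact ⟨_, J, fun j hj u hu => hhalf n n a' (by linarith) j u (hJ' j hj) hu⟩
  have hAL : ∀ (n : ℤ) (a' : ℝ), ∃ K' : ℝ, ∃ J : ℕ, ∀ j, J ≤ j → ∀ u v : ℝ, a' ≤ u → a' ≤ v →
      ‖g j n u - g j n v‖ ≤ K' * |u - v| := by
    intro n a'
    obtain ⟨J, hJ'⟩ := hJ a'
    set Bm : ℝ := B * Real.sqrt κ₂ * Real.exp (-a') * ρ ^ (n + 1) with hBm
    have hBm0 : 0 ≤ Bm := by positivity
    set K : ℝ := Bm + shiftConst α (0, 0, 0) * Bm ^ 2 + ‖bigLam ε₀‖ * (shiftConst α (0, 0, 1) * Bm ^ 2)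
      + ‖(bigLam ε₀)⁻¹‖ * ((shiftConst α (1, 0, 0) + shiftConst α (0, 1, 0)) * Bm * Bm)
      + ν * (L2 ^ n * Real.exp (-a')) * Real.sqrt κ₂ * Bm with hK
    have hlip : ∀ j, J ≤ j → ∀ u v : ℝ, a' ≤ u → u ≤ v → ‖g j n v - g j n u‖ ≤ K * (v - u) := by
      intro j hj u v hu huv
      have hderiv : ∀ t ∈ Icc u v, HasDerivWithinAt (g j n)
          (-((1 : ℝ) • g j n t) + tableQ α (g j n t) + bigLam ε₀ • tableA α (g j (n - 1) t)
            + (bigLam ε₀)⁻¹ • tableB α (g j (n + 1) t) (g j n t) - c j n t • g j n t) (Icc u v) t := fun t ht =>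
        (hlawg j n t (lt_of_lt_of_le (hJ' j hj) (hu.trans ht.1))).hasDerivWithinAt
      have hbound : ∀ t ∈ Ico u v,
          ‖-((1 : ℝ) • g j n t) + tableQ α (g j n t) + bigLam ε₀ • tableA α (g j (n - 1) t)
            + (bigLam ε₀)⁻¹ • tableB α (g j (n + 1) t) (g j n t) - c j n t • g j n t‖ ≤ K := by
        intro t ht
        have hut : a' ≤ t := hu.trans ht.1
        have hmain := norm_eternalLaw_rhs_le ε₀ α hBm0 (hhalf n n a' (by linarith) j t (hJ' j hj) hut)
          (hhalf n (n - 1) a' (by linarith) j t (hJ' j hj) hut)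
          (hhalf n (n + 1) a' le_rfl j t (hJ' j hj) hut)
        calc ‖-((1 : ℝ) • g j n t) + tableQ α (g j n t) + bigLam ε₀ • tableA α (g j (n - 1) t)
              + (bigLam ε₀)⁻¹ • tableB α (g j (n + 1) t) (g j n t) - c j n t • g j n t‖
            ≤ ‖-((1 : ℝ) • g j n t) + tableQ α (g j n t) + bigLam ε₀ • tableA α (g j (n - 1) t)
              + (bigLam ε₀)⁻¹ • tableB α (g j (n + 1) t) (g j n t)‖ + ‖c j n t • g j n t‖ := norm_sub_le _ _
          _ ≤ _ := add_le_add hmain (hcb n a' j t (hJ' j hj) hut)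
          _ = K := by rw [hK]
      exact norm_image_sub_le_of_norm_deriv_le_segment' hderiv hbound v (right_mem_Icc.2 huv)
    refine ⟨K, J, fun j hj u v hu hv => ?_⟩
    rcases le_total u v with huv | hvu
    · rw [norm_sub_rev, abs_sub_comm, abs_of_nonneg (by linarith)]
      exact hlip j hj u v hu huv
    · rw [abs_of_nonneg (by linarith)]
      exact hlip j hj v u hv hvu
  obtain ⟨φ, hφ, ⟨θi, hθi, hθconv⟩, Wlim, hconv⟩ :=
    exists_subseq_continuousLimit_param g hAB hAL θ 0 (Real.sqrt κ₂) hθmem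
  set νh : ℝ := ν * θi with hνh
  have hνh0 : 0 ≤ νh := mul_nonneg hνv hθi.1
  have hνhle : νh ≤ ν * Real.sqrt κ₂ := mul_le_mul_of_nonneg_left hθi.2 hνv
  refine ⟨νh, hνh0, hνhle, ?_⟩
  set d : ℤ → ℝ → ℝ := fun n u => νh * ((1 + ε₀) ^ ((2 : ℝ) * n) * Real.exp (-u)) with hd
  have hd_eq : ∀ (n : ℤ) (u : ℝ), d n u = ν * (L2 ^ n * Real.exp (-u)) * θi := by
    intro n u
    show ν * θi * ((1 + ε₀) ^ ((2 : ℝ) * (n : ℝ)) * Real.exp (-u)) = _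
    rw [hP2]; ring
  set Pp : ℕ → ℤ → ℝ → Em m := fun j n u => (d n u - c (φ j) n u) • g (φ j) n u with hPp
  have hav' : Tendsto (fun j => av (φ j)) atTop atBot := hav.comp hφ.tendsto_atTop
  have hlaw' : ∀ (j : ℕ) (n : ℤ) (u : ℝ), av (φ j) < u → HasDerivAt (g (φ j) n)
      (-((1 : ℝ) • g (φ j) n u) + tableQ α (g (φ j) n u) + bigLam ε₀ • tableA α (g (φ j) (n - 1) u)
        + (bigLam ε₀)⁻¹ • tableB α (g (φ j) (n + 1) u) (g (φ j) n u)
        - (νh * ((1 + ε₀) ^ ((2 : ℝ) * n) * Real.exp (-u))) • g (φ j) n u + Pp j n u) u := by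
    intro j n u hu
    refine (hlawg (φ j) n u hu).congr_deriv ?_
    show _ = _ - d n u • g (φ j) n u + (d n u - c (φ j) n u) • g (φ j) n u
    rw [sub_smul]
    abel
  have hPcont' : ∀ (j : ℕ) (n : ℤ) (u : ℝ), av (φ j) < u → ContinuousAt (Pp j n) u := by
    intro j n u hu
    have hdc : Continuous (d n) := by
      show Continuous fun u => νh * ((1 + ε₀) ^ ((2 : ℝ) * (n : ℝ)) * Real.exp (-u))
      fun_prop
    show ContinuousAt (fun v => (d n v - c (φ j) n v) • g (φ j) n v) u
    exact ((hdc.sub (hc_cont (φ j) n)).continuousAt).smul (hlawg (φ j) n u hu).continuousAt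
  have hbd' : ∀ (n : ℤ) (a' : ℝ), ∃ B' : ℝ, ∀ᶠ j in atTop, ∀ u : ℝ, a' ≤ u → ‖g (φ j) n u‖ ≤ B' := by
    intro n a'
    refine ⟨B * Real.sqrt κ₂ * Real.exp (-a') * ρ ^ (n + 1), ?_⟩
    exact (hav'.eventually (eventually_lt_atBot a')).mono fun j hj u hu => hhalf n n a' (by linarith) (φ j) u hj hu
  have hP' : ∀ (n : ℤ) (a' e : ℝ), 0 < e → ∀ᶠ j in atTop, ∀ u : ℝ, a' ≤ u → ‖Pp j n u‖ ≤ e := by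
    intro n a' e he
    set D : ℝ := ν * (L2 ^ n * Real.exp (-a')) * (B * Real.sqrt κ₂ * Real.exp (-a') * ρ ^ (n + 1)) with hD
    have hD0 : 0 ≤ D := by positivity
    have hlim : Tendsto (fun j => D * |θi - θ (φ j)|) atTop (𝓝 0) := by
      have h1 : Tendsto (fun j => θi - θ (φ j)) atTop (𝓝 0) := by
        simpa using (tendsto_const_nhds (x := θi)).sub hθconv
      simpa using (h1.abs).const_mul D
    have hsmall : ∀ᶠ j in atTop, D * |θi - θ (φ j)| ≤ e := by
      refine ((Metric.tendsto_nhds.1 hlim) e he).mono fun j hj => ?_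
      rw [Real.dist_eq, sub_zero] at hj
      exact (le_abs_self _).trans hj.le
    filter_upwards [hav'.eventually (eventually_lt_atBot a'), hsmall] with j hja hj u hu
    have hcoef : |d n u - c (φ j) n u| ≤ ν * (L2 ^ n * Real.exp (-a')) * |θi - θ (φ j)| := by
      rw [hd_eq, hc_eq, ← mul_sub, abs_mul, abs_of_nonneg (mul_nonneg hνv (mul_nonneg (zpow_pos hL2 _).le
        (Real.exp_pos _).le))]
      have h1 : Real.exp (-u) ≤ Real.exp (-a') := Real.exp_le_exp.2 (by linarith)
      exact mul_le_mul_of_nonneg_right (mul_le_mul_of_nonneg_left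
        (mul_le_mul_of_nonneg_left h1 (zpow_pos hL2 _).le) hνv) (abs_nonneg _)
    calc ‖Pp j n u‖ = |d n u - c (φ j) n u| * ‖g (φ j) n u‖ := by
          show ‖(d n u - c (φ j) n u) • g (φ j) n u‖ = _
          rw [norm_smul, Real.norm_eq_abs]
      _ ≤ ν * (L2 ^ n * Real.exp (-a')) * |θi - θ (φ j)| * (B * Real.sqrt κ₂ * Real.exp (-a') * ρ ^ (n + 1)) :=
          mul_le_mul hcoef (hhalf n n a' (by linarith) (φ j) u hja hu) (norm_nonneg _) (by positivity)
      _ = D * |θi - θ (φ j)| := by rw [hD]; ring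
      _ ≤ e := hj
  have hlaw : ∀ (n : ℤ) (σ : ℝ), HasDerivAt (Wlim n) (-((1 : ℝ) • Wlim n σ) + tableQ α (Wlim n σ)
      + bigLam ε₀ • tableA α (Wlim (n - 1) σ) + (bigLam ε₀)⁻¹ • tableB α (Wlim (n + 1) σ) (Wlim n σ)
      - (νh * ((1 + ε₀) ^ ((2 : ℝ) * n) * Real.exp (-σ))) • Wlim n σ) σ :=
    fun n σ => viscousLaw_of_perturbedLimit_local (V := fun j => g (φ j)) (P := Pp)
      hlaw' hPcont' hP' hbd' hav' hconv n σ
  have hcont : ∀ n : ℤ, Continuous (Wlim n) := fun n =>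
    continuous_iff_continuousAt.2 fun σ => (hlaw n σ).continuousAt
  have hpt : ∀ (n : ℤ) (σ : ℝ), Tendsto (fun j => g (φ j) n σ) atTop (𝓝 (Wlim n σ)) :=
    fun n σ => hconv n (fun _ => σ) σ tendsto_const_nhds
  have hev : ∀ a' : ℝ, ∀ᶠ j in atTop, av (φ j) < a' := fun a' => hav'.eventually (eventually_lt_atBot a')
  have hwin_int : ∀ (n : ℤ) (a' b : ℝ), a' ≤ b → ∫ u in a'..b, ‖Wlim n u‖ ≤ A := by
    intro n a' b hab
    have hlim : Tendsto (fun j => ∫ u in a'..b, ‖g (φ j) n u‖) atTop (𝓝 (∫ u in a'..b, ‖Wlim n u‖)) := by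
      refine intervalIntegral.tendsto_integral_filter_of_dominated_convergence
        (fun _ => B * Real.sqrt κ₂ * Real.exp (-a') * ρ ^ (n + 1)) ?_ ?_ intervalIntegrable_const ?_
      · refine (hev a').mono fun j hj => ?_
        refine ContinuousOn.aestronglyMeasurable ?_ measurableSet_uIoc
        intro u hu
        rw [Set.uIoc_of_le hab] at hu
        exact ((hlawg (φ j) n u (lt_trans hj hu.1)).continuousAt.norm).continuousWithinAt
      · refine (hev a').mono fun j hj => ae_of_all _ fun u hu => ?_
        rw [Set.uIoc_of_le hab] at hu
        rw [norm_norm]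
        exact hhalf n n a' (by linarith) (φ j) u hj hu.1.le
      · exact ae_of_all _ fun u _ => (hpt n u).norm
    refine le_of_tendsto hlim ((hev a').mono fun j hj => ?_)
    have hwa : Real.exp (-(a' + s (φ j))) < T := hwin (φ j) a' hj
    exact translate_window_action hε hC1 hW hact (n + ((φ j : ℕ) : ℤ)) (s (φ j)) hab hwa
  have haction : ∀ n : ℤ, Integrable (fun σ => ‖Wlim n σ‖) ∧ ∫ σ, ‖Wlim n σ‖ ≤ A := by
    intro n
    have hcn : Continuous (fun σ => ‖Wlim n σ‖) := (hcont n).norm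
    have hfi : ∀ i : ℕ, IntegrableOn (fun σ => ‖Wlim n σ‖) (Ioc (-(i : ℝ)) i) := fun i =>
      (hcn.integrableOn_Icc).mono_set Ioc_subset_Icc_self
    have ha : Tendsto (fun i : ℕ => -(i : ℝ)) atTop atBot :=
      tendsto_neg_atTop_atBot.comp tendsto_natCast_atTop_atTop
    have hb' : Tendsto (fun i : ℕ => (i : ℝ)) atTop atTop := tendsto_natCast_atTop_atTop
    have hii : ∀ i : ℕ, -(i : ℝ) ≤ i := fun i => by
      have h0 : (0 : ℝ) ≤ i := Nat.cast_nonneg i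
      linarith
    have hInt : Integrable (fun σ => ‖Wlim n σ‖) := by
      refine integrable_of_intervalIntegral_norm_bounded A hfi ha hb' (Eventually.of_forall fun i => ?_)
      simp only [norm_norm]
      exact hwin_int n _ _ (hii i)
    exact ⟨hInt, le_of_tendsto' (intervalIntegral_tendsto_integral hInt ha hb') fun i => hwin_int n _ _ (hii i)⟩
  have hE : ∀ (k : ℤ) (t : ℝ), 0 ≤ t → t < T → ‖shellVec X k t‖ ^ 2 ≤ B ^ 2 * (νr ^ 2) ^ k := by
    intro k t ht0 htT
    have h := pow_le_pow_left₀ (norm_nonneg _) (hamp k t ht0 htT) 2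
    rwa [mul_pow, zpow_sq_comm] at h
  have hνsq : 0 < νr ^ 2 := by positivity
  have henv : ∀ (n : ℤ) (σ : ℝ), Real.exp (2 * σ) * ‖Wlim n σ‖ ^ 2 ≤ B ^ 2 * κ₂ * q ^ n := by
    intro n σ
    have hqn : 0 < q ^ n := zpow_pos hq _
    refine le_of_tendsto ((((hpt n σ).norm).pow 2).const_mul (Real.exp (2 * σ))) ((hev σ).mono fun j hj => ?_)
    have h1 := translate_envelope hε hW hνsq hE n ((φ j : ℕ) : ℤ) (s (φ j)) σ (hwin (φ j) σ hj)
    have hM : (bigLam ε₀ ^ 2 * νr ^ 2) ^ ((φ j : ℕ) : ℤ) * Real.exp (-(2 * s (φ j))) ≤ κ₂ := by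
      have e : Real.exp (-(2 * s (φ j))) = (T - τ (φ j)) ^ 2 := by
        rw [hs_def]
        simp only [neg_neg, mul_neg]
        rw [two_mul, Real.exp_add, Real.exp_log (gap (φ j)), sq]
      rw [zpow_natCast, e]
      exact hclock₂ (φ j)
    calc Real.exp (2 * σ) * ‖g (φ j) n σ‖ ^ 2
        ≤ B ^ 2 * ((bigLam ε₀ ^ 2 * νr ^ 2) ^ ((φ j : ℕ) : ℤ) * Real.exp (-(2 * s (φ j)))) *
            (bigLam ε₀ ^ 2 * νr ^ 2) ^ n := h1
      _ = B ^ 2 * (((bigLam ε₀ ^ 2 * νr ^ 2) ^ ((φ j : ℕ) : ℤ) * Real.exp (-(2 * s (φ j)))) * q ^ n) := by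
          rw [hq_def]; ring
      _ ≤ B ^ 2 * (κ₂ * q ^ n) :=
          mul_le_mul_of_nonneg_left (mul_le_mul_of_nonneg_right hM hqn.le) (sq_nonneg _)
      _ = B ^ 2 * κ₂ * q ^ n := by ring
  have hconvS : ∀ (n : ℤ) (v : ℕ → ℝ) (σ : ℝ), Tendsto v atTop (𝓝 σ) →
      Tendsto (fun j => W (n + ((φ j : ℕ) : ℤ)) (v j + -Real.log (T - τ (φ j)))) atTop (𝓝 (Wlim n σ)) :=
    fun n v σ hv => by simpa only using hconv n v σ hv
  have hsurv : EternalSurvivingFwd a ε₀ Wlim :=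
    survivingFwd_of_firingLimit hε hW hνsq hcf hκ₁ hκ₂ hq1 hpw hτ hfloor hclock₁ hclock₂ (φ := φ) hconvS
  exact ⟨Wlim, ⟨hlaw, hνh0, ⟨A, haction⟩, fun n => ⟨0, B ^ 2 * κ₂ * q ^ n, fun σ _ => henv n σ⟩⟩, hsurv⟩

end BlowupRigidityOne

end Summit.NavierStokesRegularity.NavierStokesRegularity.Theorems

end
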